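import Summits.QuantumFields.BalabanUV.Beta.GAN24.WSlotT2TablesAn1
import Summits.QuantumFields.BalabanUV.Beta.D1BFx.RoadEnd

/-!
# `BalabanUV.Beta.D1BFx.RoadEndPinned` — road «BF-x» for binder row D1: THE MEAN-GRADING END FOR THE ROAD'S OWN LITERAL `JsBalAn1Ctr` AT THE EXACT
# PIN `cE₂ = Lc⁸`, WITH THE ALL-SCALES BINDER (bridge B2, row G-an2-4) DISCHARGED BY NAME — what remains is (B1_mean) + (T_mean) only

HONEST DEPENDENCY (page 1, mandatory): continuum YM on T⁴ ⇐ BetaPertH ∧ nine spine estimates (0/9 proved); BetaPertH ⇐ (D1) ∧ (D4) ∧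
CAP+tail; G-an2-4 gates asym, D1 and NE2/3/4.  HONEST FRAMING (cell contract, verbatim): «discharging `BetaPertH` makes Bałaban's UV
stability UNCONDITIONAL — a real constructive-QFT result; it is NOT the continuum limit and NOT the Clay problem.»  THIS MODULE DISCHARGES
NOTHING of the wall by itself: it is [folklore] composition BY NAME of this road's C2 (`RoadEnd.d1Drift_of_meanRoad`, `d1Drift_iff_cesaro`,
`d1Drift_of_meanRoad_table`) with gan24-p1's END #4 `GAN24.WSlotT2TablesAn1.allScalesSeq_secondMoment_JsBalAn1Ctr_pinned` (the `hall`/`hθ0`/`hθ1` binders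
for THIS literal with NO hypothesis beyond `2 ≤ Lc`).  The bridge (B1_mean) and the road's target (T_mean) stay HYPOTHESES; the one-shot coefficient `c` and the leg
family `Gf` stay FREE.  No `def`, no `Prop` minted, nothing printed asserted, 0 sorry.  The (P6) decision whether the `BetaPertH` wall literal IS this member is the
leads' ∕ an2's and is NOT made here.  NOT D1, NOT `BetaPertH`, NOT continuum, NOT Clay.

ABSOLUTE RULE (cell charter, verbatim): «No internally-minted statement may enter as a cited fact. Every hypothesis is either kernel-proved in
this package or a verbatim quotation of a PUBLISHED theorem with page reference. The manuscript(s) under audit are NOT citable for their own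
disputed steps — they are the thing under adjudication; programme-internal (2001/route/tribunal) claims are never citable.»

WHY (skeleton v1.6 §0 «MEAN grading»: `T_mean ∧ B1_mean ∧ B2 ⟹ D1Drift`; bridge B2 = row G-an2-4's (CONV-C-Cauchy)).  For the road's literal — O1's one-shot
coefficient is the `j = 0` member of `TbalOf n (JsBalAn1Ctr (Lc := n) …)` — gan24-p1 (END #4) proved the all-scales bound of `j ↦ β⁰_j` at the pin `cE₂ = Lc^{2(3+1)}`
outright.  Hence, for THIS literal:
* `d1Drift_JsBalAn1Ctr_iff_cesaro_pinned` — `D1Drift ⟺ (Σ_{j<m} β⁰_j)/m → stepBal N Lc`, NO hypothesis (the wall's literal term IS a Cesàro statement);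
* `d1Drift_JsBalAn1Ctr_of_meanRoad_pinned` — (B1_mean) `(Σ_{j<m} β⁰_j − c (Lc^m))/m → 0` ∧ (T_mean) `c (Lc^m)/m → stepBal N Lc` ⟹ `D1Drift`;
* `d1Drift_JsBalAn1Ctr_of_meanRoad_table_pinned` — the same with T_mean in the TABLE currency of `RoadEnd.d1Drift_of_meanRoad_table` (an3's six scalar rows
  for the leg family `Gf`, the table side drifting by itself): (B1_mean) ∧ `(c (Lc^m) − Σ_b wt·fullSum (stK μ ν N (Gf (Lc^m) b)))/m → 0` ⟹ `D1Drift`.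
So on the MEAN grading the road's END for its own literal needs EXACTLY (B1_mean) [row an4 ∕ an2: telescoping] + (T_mean) [this road: slots of `D1BFx.Assembly`
with `o(m)` bounds, `hT_mean_of_slots`].  Unit `b2b-balaban-beta-d1-p2` (road owner, gen 2); `LEAVES-BFx.md` rows C2 ∕ B2.
-/

open Finset Filter Topology
open scoped BigOperators
open Literature.MathematicalPhysics.QuantumFieldTheory.Balaban1983to89
open Literature.MathematicalPhysics.QuantumFieldTheory.Balaban1983to89.Beta
open OneStepKernelFamily (TbalOf D1Drift)
open WindowIdentification (fullSum)
open DyadicShell (Pt supNorm)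
open SquareTable (stK)
open GhostTable (gFree)
open BubbleTransfer (unitVec)
open Summit.QuantumFields.BalabanUV.Beta.MixedJetTablesPlug (JsBalAn1Ctr)
open Summit.QuantumFields.BalabanUV.Beta.GAN24.StencilSlotOfE3 (one_le_of_two_le)
open Summit.QuantumFields.BalabanUV.Beta.GAN24.WSlotT2TablesAn1 (allScalesSeq_secondMoment_JsBalAn1Ctr_pinned)
open Summit.QuantumFields.BalabanUV.Beta.D1BFx.RoadEnd (d1Drift_iff_cesaro d1Drift_of_meanRoad d1Drift_of_meanRoad_table)

namespace Summit.QuantumFields.BalabanUV.Beta.D1BFx.RoadEndPinned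

variable {Lc : ℕ} [NeZero Lc] {κB : Type*}

/-- [folklore] **FOR THE ROAD'S LITERAL AT THE PIN THE WALL'S TERM IS A CESÀRO STATEMENT, NO HYPOTHESIS**: for every `Lc ≥ 2`, every channel and
all weights `(cE, cVH, cΛ, cB)`, table `Tc`: `D1Drift Lc (JsBalAn1Ctr … Lc⁸ …) N μ ν ⟺ (Σ_{j<m} β⁰_j)/m → stepBal N Lc`. -/
theorem d1Drift_JsBalAn1Ctr_iff_cesaro_pinned (hLc : 2 ≤ Lc) (cE cVH cΛ cB : ℝ) (Tc : Fin 4 → Fin 4 → Fin 4 → Fin 4 → ℝ) (μ ν : Fin 4) (N : ℝ) :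
    D1Drift Lc (JsBalAn1Ctr (one_le_of_two_le hLc) cE cVH cΛ ((Lc : ℝ) ^ (2 * (3 + 1))) cB Tc) N μ ν ↔
      Tendsto (fun m : ℕ => (∑ j ∈ range m,
        B12Beta.secondMoment (TbalOf Lc (JsBalAn1Ctr (one_le_of_two_le hLc) cE cVH cΛ ((Lc : ℝ) ^ (2 * (3 + 1))) cB Tc) j) μ ν) / (m : ℝ))
        atTop (𝓝 (B12Normalization.stepBal N Lc)) := by
  obtain ⟨κ, θ, hθ0, hθ1, hall⟩ := allScalesSeq_secondMoment_JsBalAn1Ctr_pinned hLc cE cVH cΛ cB Tc μ ν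
  exact d1Drift_iff_cesaro _ hall hθ0 hθ1 N

/-- [folklore] **THE MEAN ROAD END FOR THE ROAD'S LITERAL AT THE PIN**: (B1_mean) a Cesàro-null telescoping defect of the step coefficients against a
one-shot coefficient `c (Lc^m)` and (T_mean) `c (Lc^m)/m → stepBal N Lc` ⟹ `D1Drift Lc (JsBalAn1Ctr … Lc⁸ …) N μ ν` — the all-scales binder is gan24-p1's
theorem, not a hypothesis. -/
theorem d1Drift_JsBalAn1Ctr_of_meanRoad_pinned (hLc : 2 ≤ Lc) (cE cVH cΛ cB : ℝ) (Tc : Fin 4 → Fin 4 → Fin 4 → Fin 4 → ℝ) (μ ν : Fin 4) (N : ℝ)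
    (c : ℕ → ℝ)
    (hB1 : Tendsto (fun m : ℕ => ((∑ j ∈ range m,
        B12Beta.secondMoment (TbalOf Lc (JsBalAn1Ctr (one_le_of_two_le hLc) cE cVH cΛ ((Lc : ℝ) ^ (2 * (3 + 1))) cB Tc) j) μ ν) - c (Lc ^ m)) / (m : ℝ))
        atTop (𝓝 0))
    (hT : Tendsto (fun m : ℕ => c (Lc ^ m) / (m : ℝ)) atTop (𝓝 (B12Normalization.stepBal N Lc))) :
    D1Drift Lc (JsBalAn1Ctr (one_le_of_two_le hLc) cE cVH cΛ ((Lc : ℝ) ^ (2 * (3 + 1))) cB Tc) N μ ν := by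
  obtain ⟨κ, θ, hθ0, hθ1, hall⟩ := allScalesSeq_secondMoment_JsBalAn1Ctr_pinned hLc cE cVH cΛ cB Tc μ ν
  exact d1Drift_of_meanRoad _ hall hθ0 hθ1 N c hB1 hT

/-- [folklore] **THE MEAN ROAD END FOR THE ROAD'S LITERAL AT THE PIN, TABLE CURRENCY**: (B1_mean), the MEAN target in the base-point-averaged full-sum
table currency over a scalar leg family `Gf` — `(c (Lc^m) − Σ_b wt·fullSum (stK μ ν N (Gf (Lc^m) b)))/m → 0` (`Assembly.hT_mean_of_slots` delivers exactly this) —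
and an3's six graded scalar rows `h0/h1/h2/d0/d1/d2` for `Gf` with convex weights ⟹ `D1Drift Lc (JsBalAn1Ctr … Lc⁸ …) N μ ν`. -/
theorem d1Drift_JsBalAn1Ctr_of_meanRoad_table_pinned (hLc : 2 ≤ Lc) (cE cVH cΛ cB : ℝ) (Tc : Fin 4 → Fin 4 → Fin 4 → Fin 4 → ℝ) {μ ν : Fin 4}
    (hμν : μ ≠ ν) {N : ℝ} (hN : N ≠ 0) (c : ℕ → ℝ) {Bset : ℕ → Finset κB} {wt : ℕ → κB → ℝ} {Gf : ℕ → κB → Pt → ℝ} {D A : ℕ → ℝ}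
    (hD : ∀ j, 0 ≤ D j) (hA : ∀ j, 0 ≤ A j) {δ : ℝ} (hδ : 0 < δ)
    (hwt0 : ∀ n : ℕ, 2 ≤ n → ∀ b ∈ Bset n, 0 ≤ wt n b) (hwt1 : ∀ n : ℕ, 2 ≤ n → ∑ b ∈ Bset n, wt n b = 1)
    (h0 : ∀ n : ℕ, 2 ≤ n → ∀ b ∈ Bset n, ∀ v, |Gf n b v - gFree v| ≤ D 0 / (n : ℝ) ^ 2)
    (h1 : ∀ n : ℕ, 2 ≤ n → ∀ b ∈ Bset n, ∀ v (ρ : Fin 4),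
      |(Gf n b (v + unitVec ρ) - gFree (v + unitVec ρ)) - (Gf n b v - gFree v)| ≤ D 1 / (n : ℝ) ^ 3)
    (h2 : ∀ n : ℕ, 2 ≤ n → ∀ b ∈ Bset n, ∀ v,
      |(Gf n b (v + unitVec ν + unitVec μ) - gFree (v + unitVec ν + unitVec μ)) - (Gf n b (v + unitVec ν) - gFree (v + unitVec ν)) -
          (Gf n b (v + unitVec μ) - gFree (v + unitVec μ)) + (Gf n b v - gFree v)| ≤ D 2 / (n : ℝ) ^ 4)
    (d0 : ∀ n : ℕ, 2 ≤ n → ∀ b ∈ Bset n, ∀ v : Pt, v ≠ 0 → |Gf n b v| ≤ A 0 * Real.exp (-(δ / n) * supNorm v) / (supNorm v : ℝ) ^ 2)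
    (d1 : ∀ n : ℕ, 2 ≤ n → ∀ b ∈ Bset n, ∀ v : Pt, v ≠ 0 → ∀ ρ : Fin 4,
      |Gf n b (v + unitVec ρ) - Gf n b v| ≤ A 1 * Real.exp (-(δ / n) * supNorm v) / (supNorm v : ℝ) ^ 3)
    (d2 : ∀ n : ℕ, 2 ≤ n → ∀ b ∈ Bset n, ∀ v : Pt, v ≠ 0 →
      |Gf n b (v + unitVec ν + unitVec μ) - Gf n b (v + unitVec ν) - Gf n b (v + unitVec μ) + Gf n b v| ≤
        A 2 * Real.exp (-(δ / n) * supNorm v) / (supNorm v : ℝ) ^ 4)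
    (hB1 : Tendsto (fun m : ℕ => ((∑ j ∈ range m,
        B12Beta.secondMoment (TbalOf Lc (JsBalAn1Ctr (one_le_of_two_le hLc) cE cVH cΛ ((Lc : ℝ) ^ (2 * (3 + 1))) cB Tc) j) μ ν) - c (Lc ^ m)) / (m : ℝ))
        atTop (𝓝 0))
    (hT : Tendsto (fun m : ℕ => (c (Lc ^ m) - ∑ b ∈ Bset (Lc ^ m), wt (Lc ^ m) b * fullSum (stK μ ν N (Gf (Lc ^ m) b))) / (m : ℝ))
      atTop (𝓝 0)) :
    D1Drift Lc (JsBalAn1Ctr (one_le_of_two_le hLc) cE cVH cΛ ((Lc : ℝ) ^ (2 * (3 + 1))) cB Tc) N μ ν := by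
  obtain ⟨κ, θ, hθ0, hθ1, hall⟩ := allScalesSeq_secondMoment_JsBalAn1Ctr_pinned hLc cE cVH cΛ cB Tc μ ν
  exact d1Drift_of_meanRoad_table _ hμν hN hLc hall hθ0 hθ1 c hD hA hδ hwt0 hwt1 h0 h1 h2 d0 d1 d2 hB1 hT

end Summit.QuantumFields.BalabanUV.Beta.D1BFx.RoadEndPinned
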